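import Summits.QuantumAdvantage.AdviceFreeQNC0.Blind39
import Summits.QuantumAdvantage.AdviceFreeQNC0.AffBells23JuntaProduct
import Literature.Computability.MetaComplexity.LowDegreeTwoModuliExpSums
import HarnessLib

/-!
# Cell qa-qnc0, `p = 3` — Claim K (`Blind39.FewTermJuntaBound`) up to a TRANSVERSAL, and PROVED in the IRREDUNDANT regime
# (prover qn-prover-3 g26)

Claim K (planner qa-qnc0-p1 g39, ROUND-38 §6.2, typed `Blind39.FewTermJuntaBound`, OPEN): for `M ≤ 2s` juntas `f_k` reading sets
`T_k` of size `≤ s` and a frequency `β`, the parity `(−1)^{#{k : f_k(x)}}` has twisted sum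
`‖Σ_x ω^{⟨β,x⟩}(−1)^{#{k : f_k x}}‖ ≤ C·κ^{⌈wU/s⌉}·2^{−(wt β − wU)}·2^N`, `wU` = number of twisted letters covered by the `T_k`.
This file proves the cube analogue of the transversal form of (R1) for such parities and reads off the part of Claim K it settles:

* **`Blind39.norm_twistedParity_le_of_transversal`** — for EVERY family (no bound on `M` or `s`) and every transversal `A` of the
  reading sets inside the covered twisted letters (`A ⊆ U ∩ supp β`, `#(T_k ∩ A) ≤ 1`):
  `‖Σ_x ω^{⟨β,x⟩}(−1)^{#{k : f_k x}}‖ ≤ (√3/2)^{#A}·2^{−(wt β − wU)}·2^N`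
  (sum out the uncovered letters exactly — each uncovered twisted letter gives `‖1 + ω^{±1}‖/2 = 1/2` —, then LEMMA JPD
  `AffBells23.norm_sum_juntaProduct_mul_char_le` on the cube of covered letters);
* **`Blind39.exists_private_of_lt`** — if `(M − 1)·s < wU` (the juntas are IRREDUNDANT: no `M − 1` of them cover the twisted letters),
  every junta owns a private twisted letter, and the private letters form a transversal of size `M ≥ ⌈wU/s⌉`;
* **`Blind39.fewTermJuntaBound_irredundant`** — hence Claim K's inequality with `κ = √3/2`, `C = 1` for all irredundant families
  (every `M`, `s`; in particular the disjoint case recorded as known in the docstring of `FewTermJuntaBound`).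

So the open core of Claim K is the REDUNDANT regime — more juntas than `⌈wU/s⌉`, pairwise overlapping so that no transversal of size
`≍ wU/s` exists (pair-covering families; planner p2's "pair-complete families beat packing", ROUND-38P2 §9) — the same residual
regime as for (R1) (`R1CellReads39`, `R1CoDegree39`).

WHAT THIS IS NOT: Claim K itself stays open; crux `stmt-QuantumAdvantage-22907` untouched.
-/

noncomputable section

namespace Summit.QuantumAdvantage.AdviceFreeQNC0

open Finset Literature.Computability.MetaComplexity

namespace Blind39

variable {N : ℕ}

/-! ## The parity sign as a junta product -/

/-- `(card % 2 = 1 ? −1 : 1) = Π_k sgnB (f k x)`. -/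
theorem paritySign_eq_prod {M : ℕ} (f : Fin M → (Fin N → Bool) → Bool) (x : Fin N → Bool) :
    (if (univ.filter fun k => f k x = true).card % 2 = 1 then (-1 : ℂ) else 1) = ∏ k, AffBells22.sgnB (f k x) := by
  rw [← AffBells22.neg_one_pow_card_filter_eq_prod_sgnB, neg_one_pow_eq_pow_mod_two]
  rcases Nat.mod_two_eq_zero_or_one (univ.filter fun k => f k x = true).card with h | h
  · rw [h]; simp
  · rw [h]; simp

/-! ## Splitting off the uncovered letters -/

/-- The linear form splits along a set `U`: `⟨β, glue U w v⟩ = Σ_{k ∈ U} [w k] β k + Σ_{k ∉ U} [v k] β k`. -/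
theorem linVal_glue (U : Finset (Fin N)) (β : Fin N → ZMod 3) (w : {i // i ∈ U} → Bool) (v : {i // i ∉ U} → Bool) :
    linVal β (TwoModuli.glue U w v)
      = (∑ k : {i // i ∈ U}, if w k then β k else 0) + (∑ k : {i // i ∉ U}, if v k then β k else 0) := by
  unfold linVal
  have e1 : (∑ k : {i // i ∈ U}, if w k then β k else 0) = ∑ k : {i // i ∈ U}, if TwoModuli.glue U w v k then β k else 0 :=
    sum_congr rfl fun k _ => by rw [TwoModuli.glue_apply_mem _ _ k.2]
  have e2 : (∑ k : {i // i ∉ U}, if v k then β k else 0) = ∑ k : {i // i ∉ U}, if TwoModuli.glue U w v k then β k else 0 :=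
    sum_congr rfl fun k _ => by rw [TwoModuli.glue_apply_not_mem _ _ k.2]
  rw [e1, e2, ← Finset.sum_subtype U (fun _ => Iff.rfl) (f := fun i => if TwoModuli.glue U w v i then β i else 0),
    ← Finset.sum_subtype (p := fun i => i ∉ U) Uᶜ (fun _ => Finset.mem_compl)
      (f := fun i => if TwoModuli.glue U w v i then β i else 0),
    Finset.sum_add_sum_compl]

/-- The free sum over the uncovered letters: `‖Σ_v ω^{Σ_{k ∉ U}[v k]β k}‖ ≤ Π_{k ∉ U} (β k ≠ 0 ? 1 : 2)`. -/
theorem norm_sum_char_uncovered_le (U : Finset (Fin N)) (β : Fin N → ZMod 3) :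
    ‖∑ v : {i // i ∉ U} → Bool, (ZMod.stdAddChar (∑ k : {i // i ∉ U}, if v k then β k else 0) : ℂ)‖
      ≤ ∏ k : {i // i ∉ U}, (if β k ≠ 0 then (1 : ℝ) else 2) := by
  classical
  have hterm : ∀ v : {i // i ∉ U} → Bool, (ZMod.stdAddChar (∑ k : {i // i ∉ U}, if v k then β k else 0) : ℂ)
      = ∏ k, (fun (k : {i // i ∉ U}) (b : Bool) => if b then (ZMod.stdAddChar (β k) : ℂ) else 1) k (v k) := by
    intro v; rw [TwoModuli.stdAddChar_sum_ite]
  rw [Fintype.sum_congr _ _ hterm,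
    TwoModuli.sum_bool_fun_prod (ι := {i // i ∉ U}) (fun (k : {i // i ∉ U}) (b : Bool) => if b then (ZMod.stdAddChar (β k) : ℂ) else 1),
    norm_prod]
  refine prod_le_prod (fun k _ => norm_nonneg _) fun k _ => ?_
  simp only [Bool.false_eq_true, if_false, if_true]
  by_cases hk : β k = 0
  · rw [if_neg (not_not.mpr hk), hk, AddChar.map_zero_eq_one]; norm_num
  · rw [if_pos hk]
    have h := TwoModuli.norm_one_add_stdAddChar_le (p := 3) hk
    have hcos : Real.cos (Real.pi / ((3 : ℕ) : ℝ)) = 1 / 2 := by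
      rw [show ((3 : ℕ) : ℝ) = 3 by norm_num, Real.cos_pi_div_three]
    rw [hcos] at h
    linarith

/-! ## The transversal form of Claim K -/

/-- **CLAIM K UP TO A TRANSVERSAL.**  For ANY family of juntas `f k` reading `T k` (no bound on their number or size), every frequency
`β` and every transversal `A ⊆ U ∩ supp β` of the reading sets (`U = ⋃_k T k`, `#(T k ∩ A) ≤ 1`):
`‖Σ_x ω^{⟨β,x⟩}·(−1)^{#{k : f k x}}‖ ≤ (√3)^{#A}·2^{#U − #A}·2^{#{i ∉ U : β i = 0}}`. -/
theorem norm_twistedParity_le_of_transversal_raw {M : ℕ} (T : Fin M → Finset (Fin N)) (f : Fin M → (Fin N → Bool) → Bool)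
    (hf : ∀ k (x x' : Fin N → Bool), (∀ i ∈ T k, x i = x' i) → f k x = f k x') (β : Fin N → ZMod 3)
    (A : Finset (Fin N)) (hAU : A ⊆ univ.biUnion T) (hA : ∀ k, (T k ∩ A).card ≤ 1) (hAβ : ∀ i ∈ A, β i ≠ 0) :
    ‖∑ x : Fin N → Bool, (ZMod.stdAddChar (linVal β x) : ℂ) *
        (if (univ.filter fun k => f k x = true).card % 2 = 1 then (-1 : ℂ) else 1)‖
      ≤ (Real.sqrt 3) ^ A.card * (2 : ℝ) ^ ((univ.biUnion T).card - A.card) *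
          (2 : ℝ) ^ (univ.filter fun i : Fin N => i ∉ univ.biUnion T ∧ β i = 0).card := by
  classical
  set U := univ.biUnion T with hUdef
  set v₀ : {i // i ∉ U} → Bool := fun _ => false with hv₀
  -- the sign depends only on the covered letters
  set σ : ({i // i ∈ U} → Bool) → ℂ := fun w => ∏ k, AffBells22.sgnB (f k (TwoModuli.glue U w v₀)) with hσ
  have hsign : ∀ (w : {i // i ∈ U} → Bool) (v : {i // i ∉ U} → Bool),
      (if (univ.filter fun k => f k (TwoModuli.glue U w v) = true).card % 2 = 1 then (-1 : ℂ) else 1) = σ w := by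
    intro w v
    rw [paritySign_eq_prod]
    refine prod_congr rfl fun k _ => ?_
    have hTU : T k ⊆ U := subset_biUnion_of_mem T (mem_univ k)
    rw [hf k (TwoModuli.glue U w v) (TwoModuli.glue U w v₀) (fun i hi => by
      rw [TwoModuli.glue_apply_mem _ _ (hTU hi), TwoModuli.glue_apply_mem _ _ (hTU hi)])]
  -- factorisation of the sum
  set χU : ({i // i ∈ U} → Bool) → ℂ := fun w => (ZMod.stdAddChar (∑ k : {i // i ∈ U}, if w k then β k else 0) : ℂ) with hχU
  set χO : ({i // i ∉ U} → Bool) → ℂ := fun v => (ZMod.stdAddChar (∑ k : {i // i ∉ U}, if v k then β k else 0) : ℂ) with hχO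
  have hfac : ∑ x : Fin N → Bool, (ZMod.stdAddChar (linVal β x) : ℂ) *
        (if (univ.filter fun k => f k x = true).card % 2 = 1 then (-1 : ℂ) else 1)
      = (∑ v : {i // i ∉ U} → Bool, χO v) * (∑ w : {i // i ∈ U} → Bool, χU w * σ w) := by
    rw [TwoModuli.sum_eq_sum_sum_glue U, sum_mul]
    refine sum_congr rfl fun v _ => ?_
    rw [mul_sum]
    refine sum_congr rfl fun w _ => ?_
    rw [hsign w v, linVal_glue, AddChar.map_add_eq_mul]
    simp only [hχU, hχO]
    ring
  rw [hfac, norm_mul]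
  -- the uncovered factor
  have hO : ‖∑ v : {i // i ∉ U} → Bool, χO v‖ ≤ (2 : ℝ) ^ (univ.filter fun i : Fin N => i ∉ U ∧ β i = 0).card := by
    refine (norm_sum_char_uncovered_le U β).trans (le_of_eq ?_)
    rw [prod_ite, prod_const_one, one_mul, prod_const]
    congr 1
    -- `#{k : {i // i ∉ U} | β k = 0} = #{i ∉ U : β i = 0}`
    have e : (univ.filter fun k : {i // i ∉ U} => ¬ β k ≠ 0)
        = (univ.filter fun i : Fin N => i ∉ U ∧ β i = 0).subtype (fun i => i ∉ U) := by
      ext k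
      simp only [mem_filter, mem_univ, true_and, not_not, mem_subtype]
      exact ⟨fun h => ⟨k.2, h⟩, fun h => h.2⟩
    rw [e, card_subtype]
    congr 1
    ext i
    simp only [mem_filter, mem_univ, true_and]
    exact ⟨fun h => h.1, fun h => ⟨h, h.1⟩⟩
  -- the covered factor: LEMMA JPD on the cube of covered letters
  have hUsum : ‖∑ w : {i // i ∈ U} → Bool, χU w * σ w‖ ≤ (Real.sqrt 3) ^ A.card * (2 : ℝ) ^ (U.card - A.card) := by
    set S : Fin M → Finset {i // i ∈ U} := fun k => univ.filter fun p => p.val ∈ T k with hS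
    set h : Fin M → ({i // i ∈ U} → Bool) → ℂ := fun k w => AffBells22.sgnB (f k (TwoModuli.glue U w v₀)) with hh
    set A' : Finset {i // i ∈ U} := univ.filter fun p => p.val ∈ A with hA'
    have hpm : ∀ k ∈ (univ : Finset (Fin M)), ∀ w, h k w = 1 ∨ h k w = -1 := fun k _ w => AffBells22.sgnB_cases _
    have hread : ∀ k ∈ (univ : Finset (Fin M)), AffBells23.ReadsOn (S k) (h k) := by
      intro k _ w w' hww'
      show AffBells22.sgnB (f k (TwoModuli.glue U w v₀)) = AffBells22.sgnB (f k (TwoModuli.glue U w' v₀))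
      congr 1
      refine hf k _ _ fun i hi => ?_
      have hiU : i ∈ U := subset_biUnion_of_mem T (mem_univ k) hi
      rw [TwoModuli.glue_apply_mem _ _ hiU, TwoModuli.glue_apply_mem _ _ hiU]
      exact hww' ⟨i, hiU⟩ (mem_filter.mpr ⟨mem_univ _, hi⟩)
    have hA'1 : ∀ k ∈ (univ : Finset (Fin M)), (S k ∩ A').card ≤ 1 := by
      intro k _
      rw [Finset.card_le_one]
      intro p hp q hq
      rw [mem_inter] at hp hq
      have hp' : p.val ∈ T k ∩ A := mem_inter.mpr ⟨(mem_filter.mp hp.1).2, (mem_filter.mp hp.2).2⟩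
      have hq' : q.val ∈ T k ∩ A := mem_inter.mpr ⟨(mem_filter.mp hq.1).2, (mem_filter.mp hq.2).2⟩
      exact Subtype.ext (Finset.card_le_one.mp (hA k) _ hp' _ hq')
    have hΨ : AffBells22.IsCoordProduct (fun _ : {i // i ∈ U} → Bool => (1 : ℂ)) :=
      AffBells22.isCoordProduct_const (Or.inl rfl)
    have hJ := AffBells23.norm_sum_juntaProduct_mul_char_le (univ : Finset (Fin M)) S h hpm hread hΨ
      (fun k : {i // i ∈ U} => β k) A' hA'1
    have hrw : ∑ w : {i // i ∈ U} → Bool, χU w * σ w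
        = ∑ w : {i // i ∈ U} → Bool, ((1 : ℂ) * ∏ k ∈ (univ : Finset (Fin M)), h k w) *
            (ZMod.stdAddChar (∑ k : {i // i ∈ U}, if w k then β k else 0) : ℂ) := by
      refine sum_congr rfl fun w _ => ?_
      simp only [hχU, hσ, hh]
      ring
    rw [hrw]
    refine hJ.trans (le_of_eq ?_)
    -- `Π_p (p ∈ A' ∧ β p ≠ 0 ? √3 : 2) = √3^{#A} · 2^{#U − #A}`
    have hfilt : (univ.filter fun p : {i // i ∈ U} => p ∈ A' ∧ β p ≠ 0) = A' := by
      ext p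
      simp only [mem_filter, mem_univ, true_and, hA']
      exact ⟨fun h => h.1, fun h => ⟨h, hAβ _ h⟩⟩
    have hcardA' : A'.card = A.card := by
      have e : A' = A.subtype (fun i => i ∈ U) := by
        ext p; simp only [hA', mem_filter, mem_univ, true_and, mem_subtype]
      rw [e, card_subtype]
      congr 1
      exact filter_true_of_mem fun i hi => hAU hi
    rw [prod_ite, prod_const, prod_const, hfilt, hcardA']
    congr 1
    have hc : (univ.filter fun p : {i // i ∈ U} => ¬ (p ∈ A' ∧ β p ≠ 0)).card = U.card - A.card := by
      have h1 := card_filter_add_card_filter_not (s := (univ : Finset {i // i ∈ U})) (fun p => p ∈ A' ∧ β p ≠ 0)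
      rw [hfilt, hcardA', card_univ, Fintype.card_coe] at h1
      omega
    rw [hc]
  -- assemble
  calc ‖∑ v : {i // i ∉ U} → Bool, χO v‖ * ‖∑ w : {i // i ∈ U} → Bool, χU w * σ w‖
      ≤ (2 : ℝ) ^ (univ.filter fun i : Fin N => i ∉ U ∧ β i = 0).card * ((Real.sqrt 3) ^ A.card * (2 : ℝ) ^ (U.card - A.card)) :=
        mul_le_mul hO hUsum (norm_nonneg _) (by positivity)
    _ = (Real.sqrt 3) ^ A.card * (2 : ℝ) ^ (U.card - A.card) *
          (2 : ℝ) ^ (univ.filter fun i : Fin N => i ∉ U ∧ β i = 0).card := by ring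

/-- **CLAIM K UP TO A TRANSVERSAL, in the format of `FewTermJuntaBound`**: for every transversal `A ⊆ U ∩ supp β` of the reading sets,
`‖Σ_x ω^{⟨β,x⟩}·(−1)^{#{k : f k x}}‖ ≤ (√3/2)^{#A}·2^{−(wt β − wU)}·2^N`, `wU = #{i ∈ U : β i ≠ 0}` — no hypothesis on `M` or `s`. -/
theorem norm_twistedParity_le_of_transversal {M : ℕ} (T : Fin M → Finset (Fin N)) (f : Fin M → (Fin N → Bool) → Bool)
    (hf : ∀ k (x x' : Fin N → Bool), (∀ i ∈ T k, x i = x' i) → f k x = f k x') (β : Fin N → ZMod 3)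
    (A : Finset (Fin N)) (hAU : A ⊆ univ.biUnion T) (hA : ∀ k, (T k ∩ A).card ≤ 1) (hAβ : ∀ i ∈ A, β i ≠ 0) :
    ‖∑ x : Fin N → Bool, (ZMod.stdAddChar (linVal β x) : ℂ) *
        (if (univ.filter fun k => f k x = true).card % 2 = 1 then (-1 : ℂ) else 1)‖
      ≤ (Real.sqrt 3 / 2) ^ A.card *
          (2 : ℝ)⁻¹ ^ (wt β - ((univ.biUnion T).filter fun i => β i ≠ 0).card) * (2 : ℝ) ^ N := by
  classical
  set U := univ.biUnion T with hUdef
  refine (norm_twistedParity_le_of_transversal_raw T f hf β A hAU hA hAβ).trans (le_of_eq ?_)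
  -- the counts
  set z := (univ.filter fun i : Fin N => i ∉ U ∧ β i = 0).card with hz
  set t := (univ.filter fun i : Fin N => i ∉ U ∧ β i ≠ 0).card with ht
  have hAu : A.card ≤ U.card := card_le_card hAU
  have hOut : (univ.filter fun i : Fin N => i ∉ U).card = z + t := by
    rw [hz, ht, ← card_filter_add_card_filter_not (s := univ.filter fun i : Fin N => i ∉ U) (fun i => β i = 0),
      filter_filter, filter_filter]
  have hUN : U.card + (univ.filter fun i : Fin N => i ∉ U).card = N := by
    have h := card_filter_add_card_filter_not (s := (univ : Finset (Fin N))) (fun i => i ∈ U)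
    rw [card_univ, Fintype.card_fin, filter_mem_eq_inter, univ_inter] at h
    exact h
  have hwt : wt β = (U.filter fun i => β i ≠ 0).card + t := by
    unfold wt
    rw [ht, ← card_filter_add_card_filter_not (s := univ.filter fun i : Fin N => β i ≠ 0) (fun i => i ∈ U),
      filter_filter, filter_filter]
    congr 1
    · congr 1; ext i; simp [and_comm]
    · congr 1; ext i; simp [and_comm]
  have htw : wt β - (U.filter fun i => β i ≠ 0).card = t := by omega
  rw [htw]
  have hN : N = ((U.card - A.card) + z) + (A.card + t) := by omega
  -- the real identity
  have hN' : (2 : ℝ) ^ N = (2 : ℝ) ^ (U.card - A.card) * 2 ^ z * (2 ^ A.card * 2 ^ t) := by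
    have e := congrArg (fun n : ℕ => (2 : ℝ) ^ n) hN
    simp only [pow_add] at e
    rw [e]
  rw [hN', div_pow, inv_pow]
  have hUU : (univ.biUnion T).card = U.card := rfl
  rw [hUU]
  field_simp

/-! ## The irredundant regime: private letters -/

/-- **Irredundant families have private twisted letters.**  If `#T k ≤ s` for all `k` and `(M − 1)·s < wU`, then every junta `k`
reads a twisted letter read by no other junta. -/
theorem exists_private_of_lt {M s : ℕ} (T : Fin M → Finset (Fin N)) (hTs : ∀ k, (T k).card ≤ s) (β : Fin N → ZMod 3)
    (hlt : (M - 1) * s < ((univ.biUnion T).filter fun i => β i ≠ 0).card) (k : Fin M) :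
    ∃ i ∈ T k, β i ≠ 0 ∧ ∀ j, j ≠ k → i ∉ T j := by
  classical
  set V := (univ.erase k).biUnion T with hV
  have hVcard : V.card ≤ (M - 1) * s := by
    refine card_biUnion_le.trans ?_
    calc ∑ j ∈ univ.erase k, (T j).card ≤ ∑ _j ∈ univ.erase k, s := sum_le_sum fun j _ => hTs j
      _ = (M - 1) * s := by rw [sum_const, card_erase_of_mem (mem_univ k), card_univ, Fintype.card_fin, smul_eq_mul]
  have hlt' : V.card < ((univ.biUnion T).filter fun i => β i ≠ 0).card := lt_of_le_of_lt hVcard hlt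
  obtain ⟨i, hi, hiV⟩ := exists_mem_notMem_of_card_lt_card hlt'
  rw [mem_filter, mem_biUnion] at hi
  obtain ⟨⟨j₀, -, hj₀⟩, hβi⟩ := hi
  have hnot : ∀ j, j ≠ k → i ∉ T j := by
    intro j hj hij
    exact hiV (mem_biUnion.mpr ⟨j, mem_erase.mpr ⟨hj, mem_univ j⟩, hij⟩)
  have hjk : j₀ = k := by
    by_contra h
    exact hnot j₀ h hj₀
  subst hjk
  exact ⟨i, hj₀, hβi, hnot⟩

/-- **CLAIM K IN THE IRREDUNDANT REGIME** (`κ = √3/2`, `C = 1`).  If the `M` juntas of size `≤ s` satisfy `(M − 1)·s < wU` (no `M − 1` of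
them cover the twisted letters of `U`), the inequality of `Blind39.FewTermJuntaBound` holds:
`‖Σ_x ω^{⟨β,x⟩}(−1)^{#{k : f k x}}‖ ≤ (√3/2)^{⌈wU/s⌉}·2^{−(wt β − wU)}·2^N`.  (Private twisted letters form a transversal of size
`M ≥ ⌈wU/s⌉`.)  No hypothesis `M ≤ 2s` is needed. -/
theorem fewTermJuntaBound_irredundant (s M : ℕ) (T : Fin M → Finset (Fin N)) (f : Fin M → (Fin N → Bool) → Bool)
    (hTs : ∀ k, (T k).card ≤ s) (hf : ∀ k (x x' : Fin N → Bool), (∀ i ∈ T k, x i = x' i) → f k x = f k x')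
    (β : Fin N → ZMod 3) (hirr : (M - 1) * s < ((univ.biUnion T).filter fun i => β i ≠ 0).card) :
    ‖∑ x : Fin N → Bool, (ZMod.stdAddChar (linVal β x) : ℂ) *
        (if (univ.filter fun k => f k x = true).card % 2 = 1 then (-1 : ℂ) else 1)‖
      ≤ 1 * (Real.sqrt 3 / 2) ^ ((((univ.biUnion T).filter fun i => β i ≠ 0).card + s - 1) / s) *
          (2 : ℝ)⁻¹ ^ (wt β - ((univ.biUnion T).filter fun i => β i ≠ 0).card) * (2 : ℝ) ^ N := by
  classical
  set U := univ.biUnion T with hUdef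
  set wU := (U.filter fun i => β i ≠ 0).card with hwU
  -- private letters and the transversal they form
  choose p hpT hpβ hpriv using exists_private_of_lt T hTs β hirr
  set A := univ.image p with hAdef
  have hpinj : Function.Injective p := by
    intro k k' h
    by_contra hne
    exact hpriv k' k hne (h ▸ hpT k)
  have hAcard : A.card = M := by
    rw [hAdef, card_image_of_injective _ hpinj, card_univ, Fintype.card_fin]
  have hAU : A ⊆ U := by
    intro i hi
    obtain ⟨k, -, rfl⟩ := mem_image.mp hi
    exact mem_biUnion.mpr ⟨k, mem_univ k, hpT k⟩
  have hA : ∀ k, (T k ∩ A).card ≤ 1 := by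
    intro k
    refine card_le_one.mpr fun i hi i' hi' => ?_
    obtain ⟨j, -, rfl⟩ := mem_image.mp (mem_inter.mp hi).2
    obtain ⟨j', -, rfl⟩ := mem_image.mp (mem_inter.mp hi').2
    have hj : j = k := by
      by_contra h; exact hpriv j k (Ne.symm h) (mem_inter.mp hi).1
    have hj' : j' = k := by
      by_contra h; exact hpriv j' k (Ne.symm h) (mem_inter.mp hi').1
    rw [hj, hj']
  have hAβ : ∀ i ∈ A, β i ≠ 0 := by
    intro i hi
    obtain ⟨k, -, rfl⟩ := mem_image.mp hi
    exact hpβ k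
  refine (norm_twistedParity_le_of_transversal T f hf β A hAU hA hAβ).trans ?_
  rw [hAcard, one_mul]
  -- `⌈wU/s⌉ ≤ M` since `wU ≤ M·s`
  have hs : 0 < s := by
    rcases Nat.eq_zero_or_pos s with h0 | hpos
    · exfalso
      have hU0 : wU ≤ U.card := card_filter_le _ _
      have hUle : U.card ≤ M * s := by
        refine card_biUnion_le.trans ?_
        calc ∑ j ∈ (univ : Finset (Fin M)), (T j).card ≤ ∑ _j ∈ (univ : Finset (Fin M)), s := sum_le_sum fun j _ => hTs j
          _ = M * s := by rw [sum_const, card_univ, Fintype.card_fin, smul_eq_mul]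
      rw [h0, mul_zero] at hUle hirr
      omega
    · exact hpos
  have hwUle : wU ≤ M * s := by
    refine (card_filter_le _ _).trans (card_biUnion_le.trans ?_)
    calc ∑ j ∈ (univ : Finset (Fin M)), (T j).card ≤ ∑ _j ∈ (univ : Finset (Fin M)), s := sum_le_sum fun j _ => hTs j
      _ = M * s := by rw [sum_const, card_univ, Fintype.card_fin, smul_eq_mul]
  have hceil : (wU + s - 1) / s ≤ M := by
    rw [Nat.div_le_iff_le_mul_add_pred hs]
    have : M * s = s * M := mul_comm _ _
    omega
  have hκ0 : (0 : ℝ) ≤ Real.sqrt 3 / 2 := by positivity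
  have hκ1 : Real.sqrt 3 / 2 ≤ 1 := by linarith [AffBells22.sqrt_three_le]
  have hpow : (Real.sqrt 3 / 2) ^ M ≤ (Real.sqrt 3 / 2) ^ ((wU + s - 1) / s) := pow_le_pow_of_le_one hκ0 hκ1 hceil
  have hpos : (0 : ℝ) ≤ (2 : ℝ)⁻¹ ^ (wt β - wU) * (2 : ℝ) ^ N := by positivity
  calc (Real.sqrt 3 / 2) ^ M * (2 : ℝ)⁻¹ ^ (wt β - wU) * (2 : ℝ) ^ N
      = (Real.sqrt 3 / 2) ^ M * ((2 : ℝ)⁻¹ ^ (wt β - wU) * (2 : ℝ) ^ N) := by ring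
    _ ≤ (Real.sqrt 3 / 2) ^ ((wU + s - 1) / s) * ((2 : ℝ)⁻¹ ^ (wt β - wU) * (2 : ℝ) ^ N) :=
        mul_le_mul_of_nonneg_right hpow hpos
    _ = _ := by ring

end Blind39

end Summit.QuantumAdvantage.AdviceFreeQNC0

end
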